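import Mathlib
import Literature.NumberTheory.Automorphic.WohlfahrtTheorem
import HarnessLib

/-!
# THEOREM A (cell memo HOME/p2/g29/THEOREM-A-v2.md), step (5), the group-theoretic core: for ODD `N`, no subgroup of index `2` of
# `Γ₁(N)` contains `Γ(N)`

Support lemma for the crux (★-GO₂^Σ) `StarGO2Sigma` (item stmt-BirchSwinnertonDyer-27046, child of the load-bearing crux E1M_NSF of route
`EisensteinDepletionAtTwo`; line `ubd` of the aside 24444): on paper (★-GO₂^Σ) ⇐ Serre-dlog (S′) + THEOREM A «a ℚ-rational 2-torsion
point of `J₀(N)`, `N` odd, FORMAL at `2`, lies in the Shimura subgroup `Σ_N`», whose proof ends as follows: the étale double cover of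
`X₁(N)` cut out by such a point has monodromy group `Γ′ ⊂ Γ₁(N)` of index `2`; unbounded denominators (Calegari–Dimitrov–Tang) make
`Γ′` a congruence subgroup, Wohlfahrt gives `Γ′ ⊇ Γ(N)`, and then — THIS FILE — `Γ′/Γ(N)` would be an index-`2` subgroup of
`Γ₁(N)/Γ(N) ≅ ℤ/N`, impossible for `N` odd.  Elementary content (no modular curves): every `γ ∈ Γ₁(N)` is `(γ·T^{-b})·T^{b}` with
`γ·T^{-b} ∈ Γ(N)` (`b = γ₀₁`), so a subgroup `H` with `Γ(N) ≤ H` that contains the square of every element of `Γ₁(N)` contains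
`T = T^N · (T²)^{-(N-1)/2}` and hence all of `Γ₁(N)`.

CONTENT: `mul_T_zpow_neg_mem_Gamma_of_mem_Gamma1`, `Gamma1_le_of_Gamma_le_of_sq_mem` (the core, subtype-free),
`Gamma1_subgroup_index_ne_two_of_Gamma_le` (index form inside `Γ₁(N)`); and, with the TREE's Wohlfahrt theorem
(`Literature/NumberTheory/Automorphic/WohlfahrtTheorem.lean`), steps (4)–(5) of THEOREM A modulo unbounded denominators:
`not_isCongruenceSubgroup_of_relIndex_Gamma1_eq_two` — for odd `N` an index-2 subgroup of `Γ₁(N)` containing all conjugates of `T^N`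
(a double cover of `X₁(N)` étale at the cusps) is NON-CONGRUENCE.  HONEST FRAMING: a brick of a paper proof whose other bricks
(Néron models of `J₀(N)` over `ℤ₂`, the q-expansion principle on `X_μ(N)`, unbounded denominators as a named fact) are NOT in the tree;
nothing here proves (★-GO₂^Σ), E1M_NSF or BSD.  References: K. Wohlfahrt, Illinois J. Math. 8 (1964) 529–535 [Wohlfahrt1964];
F. Calegari, V. Dimitrov, Y. Tang, J. Amer. Math. Soc. 38 (2025) Thm. 1.0.1 [CalegariDimitrovTang2025]; cell memo THEOREM-A-v2.md step (5).
-/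

set_option linter.dupNamespace false
set_option autoImplicit false

open scoped MatrixGroups
open CongruenceSubgroup Matrix.SpecialLinearGroup

namespace Summit.BirchSwinnertonDyer.BirchSwinnertonDyer.Theorems.DepletionAtTwo.UBD

/-- **Translation normal form in `Γ₁(N)`**: for `γ ∈ Γ₁(N)` with upper-right entry `b`, `γ · T^{-b} ∈ Γ(N)` — i.e. `Γ₁(N)/Γ(N)` is
generated by the image of `T = [[1,1],[0,1]]`. [folklore] -/
theorem mul_T_zpow_neg_mem_Gamma_of_mem_Gamma1 {N : ℕ} {γ : SL(2, ℤ)} (h : γ ∈ Gamma1 N) :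
    γ * ModularGroup.T ^ (-(γ 0 1)) ∈ Gamma N := by
  rw [Gamma1_mem] at h
  obtain ⟨h00, h11, h10⟩ := h
  have hmul : (γ * ModularGroup.T ^ (-(γ 0 1))).1 = γ.1 * !![(1 : ℤ), -(γ 0 1); 0, 1] := by
    rw [Matrix.SpecialLinearGroup.coe_mul, ModularGroup.coe_T_zpow]
  rw [Gamma_mem]
  have e00 : (γ * ModularGroup.T ^ (-(γ 0 1))) 0 0 = γ 0 0 := by
    rw [hmul]; simp [Matrix.mul_apply, Fin.sum_univ_two]
  have e01 : (γ * ModularGroup.T ^ (-(γ 0 1))) 0 1 = -(γ 0 0 * γ 0 1) + γ 0 1 := by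
    rw [hmul]; simp [Matrix.mul_apply, Fin.sum_univ_two]
  have e10 : (γ * ModularGroup.T ^ (-(γ 0 1))) 1 0 = γ 1 0 := by
    rw [hmul]; simp [Matrix.mul_apply, Fin.sum_univ_two]
  have e11 : (γ * ModularGroup.T ^ (-(γ 0 1))) 1 1 = -(γ 1 0 * γ 0 1) + γ 1 1 := by
    rw [hmul]; simp [Matrix.mul_apply, Fin.sum_univ_two]
  refine ⟨by rw [e00]; exact h00, ?_, by rw [e10]; exact h10, ?_⟩
  · rw [e01]; push_cast; rw [h00]; ring
  · rw [e11]; push_cast; rw [h10, h11]; ring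

/-- `T ∈ Γ₁(N)`. [folklore] -/
theorem T_mem_Gamma1 (N : ℕ) : ModularGroup.T ∈ Gamma1 N := by
  rw [Gamma1_mem]
  simp [ModularGroup.T]

/-- **The core of step (5): for odd `N`, a subgroup `H ≥ Γ(N)` of `SL(2,ℤ)` containing the square of every element of `Γ₁(N)`
contains `Γ₁(N)`.**  (`T^N ∈ Γ(N) ≤ H` and `T² ∈ H` give `T ∈ H` as `N` is odd; then `γ = (γ T^{-b}) T^{b} ∈ H`.) [folklore] -/
theorem Gamma1_le_of_Gamma_le_of_sq_mem {N : ℕ} (hN : Odd N) {H : Subgroup SL(2, ℤ)} (hΓ : Gamma N ≤ H)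
    (hsq : ∀ γ ∈ Gamma1 N, γ * γ ∈ H) : Gamma1 N ≤ H := by
  -- `T ∈ H`
  have hTN : ModularGroup.T ^ (N : ℤ) ∈ H := by
    apply hΓ
    have := ModularGroup_T_pow_mem_Gamma (N : ℤ) (N : ℤ) dvd_rfl
    simpa using this
  have hT2 : ModularGroup.T ^ (2 : ℤ) ∈ H := by
    rw [zpow_two]; exact hsq _ (T_mem_Gamma1 N)
  obtain ⟨k, hk⟩ := hN
  have hT : ModularGroup.T ∈ H := by
    have e : ModularGroup.T = ModularGroup.T ^ (N : ℤ) * (ModularGroup.T ^ (2 : ℤ)) ^ (-(k : ℤ)) := by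
      rw [← zpow_mul, ← zpow_add, hk]; push_cast; ring_nf; exact (zpow_one _).symm
    rw [e]
    exact H.mul_mem hTN (H.zpow_mem hT2 _)
  -- `γ = (γ T^{-b}) · T^{b}`
  intro γ hγ
  have h1 : γ * ModularGroup.T ^ (-(γ 0 1)) ∈ H := hΓ (mul_T_zpow_neg_mem_Gamma_of_mem_Gamma1 hγ)
  have h2 : ModularGroup.T ^ (γ 0 1) ∈ H := H.zpow_mem hT _
  have e : γ = γ * ModularGroup.T ^ (-(γ 0 1)) * ModularGroup.T ^ (γ 0 1) := by
    rw [mul_assoc, ← zpow_add, neg_add_cancel, zpow_zero, mul_one]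
  rw [e]
  exact H.mul_mem h1 h2

/-- **Step (5) of THEOREM A, index form: for odd `N`, `Γ₁(N)` has NO subgroup of index `2` containing `Γ(N) ∩ Γ₁(N)`** (equivalently
`Γ₁(N)/Γ(N) ≅ ℤ/N` has no index-`2` subgroup).  In THEOREM A this kills the putative étale double cover of `X₁(N)` attached to a formal
rational `2`-torsion point of `J₀(N)` once unbounded denominators + Wohlfahrt have made its monodromy group a congruence subgroup of level `N`.
[folklore] -/
theorem Gamma1_subgroup_index_ne_two_of_Gamma_le {N : ℕ} (hN : Odd N) (H : Subgroup (Gamma1 N))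
    (hΓ : (Gamma N).subgroupOf (Gamma1 N) ≤ H) : H.index ≠ 2 := by
  intro h2
  -- pull `H` back to `SL(2,ℤ)`
  set H' : Subgroup SL(2, ℤ) := H.map (Gamma1 N).subtype with hH'
  have hΓ' : Gamma N ⊓ Gamma1 N ≤ H' := by
    rw [hH', ← Subgroup.subgroupOf_map_subtype]
    exact Subgroup.map_mono hΓ
  have hsq : ∀ γ ∈ Gamma1 N, γ * γ ∈ H' := by
    intro γ hγ
    have := Subgroup.mul_self_mem_of_index_two h2 ⟨γ, hγ⟩
    exact ⟨⟨γ, hγ⟩ * ⟨γ, hγ⟩, this, rfl⟩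
  -- the core lemma applied to `H' ⊔`-free version: use `H'' := H' ⊔ Γ(N)`?  No: `Γ(N) ≤ Γ₁(N)`, so `Γ(N) ⊓ Γ₁(N) = Γ(N)`.
  have hΓle : Gamma N ≤ Gamma1 N := by
    intro γ hγ
    rw [Gamma_mem] at hγ
    rw [Gamma1_mem]
    exact ⟨hγ.1, hγ.2.2.2, hγ.2.2.1⟩
  have hΓ'' : Gamma N ≤ H' := fun γ hγ ↦ hΓ' ⟨hγ, hΓle hγ⟩
  have hle : Gamma1 N ≤ H' := Gamma1_le_of_Gamma_le_of_sq_mem hN hΓ'' hsq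
  -- hence `H = ⊤`, index `1`
  have htop : H = ⊤ := by
    rw [eq_top_iff]
    rintro ⟨γ, hγ⟩ -
    obtain ⟨⟨δ, hδ⟩, hδH, hδγ⟩ := hle hγ
    have : (⟨δ, hδ⟩ : Gamma1 N) = ⟨γ, hγ⟩ := Subtype.ext (by simpa using hδγ)
    exact this ▸ hδH
  rw [htop, Subgroup.index_top] at h2
  exact absurd h2 (by norm_num)

/-! ## Steps (4)–(5) of THEOREM A modulo unbounded denominators: the étale double cover is NON-CONGRUENCE (appended, GEN 6) -/

/-- Every `SL(2,ℤ)`-conjugate of `T^N` lies in `Γ(N)` (which is normal), hence in `Γ₁(N)`: the cusp widths of `Γ₁(N)` divide `N`. [folklore] -/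
theorem conj_T_pow_mem_Gamma1 (N : ℕ) (g : SL(2, ℤ)) : g * ModularGroup.T ^ N * g⁻¹ ∈ Gamma1 N := by
  have hT : ModularGroup.T ^ N ∈ Gamma N := by
    have := ModularGroup_T_pow_mem_Gamma (N : ℤ) (N : ℤ) dvd_rfl
    simpa using this
  have hconj : g * ModularGroup.T ^ N * g⁻¹ ∈ Gamma N := (Gamma_normal N).conj_mem _ hT g
  have hγ := hconj
  rw [Gamma_mem] at hγ
  rw [Gamma1_mem]
  exact ⟨hγ.1, hγ.2.2.2, hγ.2.2.1⟩

/-- **THEOREM A, steps (4)–(5) modulo unbounded denominators: for odd `N`, a subgroup `Γ′` of relative index `2` in `Γ₁(N)` (e.g. `Γ′ ≤ Γ₁(N)` of index `2`) that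
contains every `SL(2,ℤ)`-conjugate of `T^N` (as the monodromy group of a double cover of `X₁(N)` ÉTALE AT THE CUSPS does: its cusp
widths are those of `Γ₁(N)`, which divide `N`) is NOT a congruence subgroup.**  Proof: were it congruence, Wohlfahrt's theorem (tree
`Gamma_le_of_isCongruenceSubgroup_of_forall_conj_T_pow_mem`) would give `Γ(N) ≤ Γ′`; index `2` puts every square of `Γ₁(N)` in `Γ′`;
`Gamma1_le_of_Gamma_le_of_sq_mem` then forces `Γ₁(N) ≤ Γ′`, i.e. relative index `1`.  In THEOREM A the cover is cut out by a formal
rational `2`-torsion point of `J₀(N)` pulled back to `X₁(N)`, and unbounded denominators (Calegari–Dimitrov–Tang) applied to its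
anti-invariant weight-2 forms says `Γ′` IS congruence — contradiction, so the point is Shimura. [cite: CalegariDimitrovTang2025, §4.1 and Lemma 30]
[cite: Wohlfahrt1964, Thm. 2] -/
theorem not_isCongruenceSubgroup_of_relIndex_Gamma1_eq_two {N : ℕ} (hN : Odd N) {H : Subgroup SL(2, ℤ)}
    (hidx : H.relIndex (Gamma1 N) = 2)
    (hpar : ∀ g : SL(2, ℤ), g * ModularGroup.T ^ N * g⁻¹ ∈ H) : ¬ IsCongruenceSubgroup H := by
  intro hcong
  -- Wohlfahrt: `Γ(N) ≤ H`
  have hΓ : Gamma N ≤ H :=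
    Literature.NumberTheory.Automorphic.Wohlfahrt.Gamma_le_of_isCongruenceSubgroup_of_forall_conj_T_pow_mem hcong hpar
  -- index 2 in `Γ₁(N)`: squares of `Γ₁(N)` lie in `H`
  have hsq : ∀ γ ∈ Gamma1 N, γ * γ ∈ H := by
    intro γ hγ
    have h2 : (H.subgroupOf (Gamma1 N)).index = 2 := hidx
    have := Subgroup.mul_self_mem_of_index_two h2 ⟨γ, hγ⟩
    rw [Subgroup.mem_subgroupOf] at this
    exact this
  have hall : Gamma1 N ≤ H := Gamma1_le_of_Gamma_le_of_sq_mem hN hΓ hsq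
  have h1 : H.relIndex (Gamma1 N) = 1 := Subgroup.relIndex_eq_one.mpr hall
  rw [h1] at hidx
  exact absurd hidx (by norm_num)

/-- **The same, with the hypothesis «every parabolic element of `Γ₁(N)` lies in `Γ′`»** (étale at all cusps), which is how the double
cover of THEOREM A presents itself. [cite: CalegariDimitrovTang2025, §4.1 and Lemma 30] [cite: Wohlfahrt1964, Thm. 2] -/
theorem not_isCongruenceSubgroup_of_relIndex_Gamma1_eq_two_of_parabolic {N : ℕ} (hN : Odd N) {H : Subgroup SL(2, ℤ)}
    (hidx : H.relIndex (Gamma1 N) = 2)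
    (hpar : ∀ (g : SL(2, ℤ)) (k : ℤ), g * ModularGroup.T ^ k * g⁻¹ ∈ Gamma1 N → g * ModularGroup.T ^ k * g⁻¹ ∈ H) :
    ¬ IsCongruenceSubgroup H :=
  not_isCongruenceSubgroup_of_relIndex_Gamma1_eq_two hN hidx fun g ↦ by
    have := hpar g (N : ℤ) (by simpa using conj_T_pow_mem_Gamma1 N g)
    simpa using this

end Summit.BirchSwinnertonDyer.BirchSwinnertonDyer.Theorems.DepletionAtTwo.UBD
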